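import Literature.Probability.Percolation.PercolationLevelOne
import Summits.CriticalPhenomena.PercolationContinuityZ3.Theorems.PercNearOneGluingNoHeavyQuantOneArmLevelOne
import Summits.CriticalPhenomena.PercolationContinuityZ3.Theorems.PercNearOneGluingNoHeavyQuantCrossingWindowOneArm
import Summits.CriticalPhenomena.PercolationContinuityZ3.Theorems.PercAnnulusCrossingOneArmQuasiMultDoubling
import Summits.CriticalPhenomena.PercolationContinuityZ3.Theorems.PercNearOneGluingNoHeavyQuantExponentCeilings
import HarnessLib

/-!
# QUANT lane (p4 gen 15): Gaussian LOWER bounds below `p_c` from the Level-1 inequality — the subcritical annulus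
# crossing `u_{p_c−s}(L,4L) ≥ exp(−(√(d log 85) + √(m/8)·s/((p_c−s)(1−p_c)))²)` and the subcritical one-arm probability

builds on p205010 (kernel theorem, internal audit signed; external expert review pending) — NOT used in this file.

Seat `prim-quant-p4` (METHOD = differential inequalities near `p_c`), helper `--supports stmt-CriticalPhenomena-4575`; pure proofs.
Notation: `u_r(L) = P_r(boxCrossing d L (4L)) = P_r(Λ(L) ↔ ∂ⁱⁿΛ(4L) in Λ(4L))` (`SurfaceTension.crossProb`), `m = #edgesIn(Λ_{4L})`,
`θ_n(r) = DCT16.thetaN d n r`, `m_n = #edgesIn(Λ_n)`.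

THE POINT.  Integrated DOWNWARD from `p` to `q < p`, the Moore–Shannon / CCFS bound `√u_q ≥ √u_p − ((p−q)/2)√(m/(q(1−p)))`
(lane 3, gen 14 `CrossingRevealment.sqrt_real_boxCrossing_le_oneArm`) is VACUOUS as soon as `(p − q)√m ≳ √u_p` — outside the CCFS
window it says nothing.  The Russo–Talagrand (Level-1) bound `u' ≤ u√(m log(1/u)/2)/(r(1−r))` (this generation,
`LevelOne.deriv_real_event_le`) integrates instead to
  `√(log(1/u_q)) ≤ √(log(1/u_p)) + √(m/8)·(p − q)/(q(1−p))`      (`sqrt_neg_log_crossing_le`),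
which never degenerates: **`u_q ≥ exp(−(√(log(1/u_p)) + √(m/8)(p−q)/(q(1−p)))²)`** (`crossing_ge_exp_neg_sq`).  With the tree's
a-priori bound `u_{p_c}(L,4L) ≥ 85^{−d}` (`SurfaceTension.le_crossProb_criticalProbI`, every `d ≥ 2`, `L ≥ 1`) this is a fully explicit
Gaussian-in-`s` lower bound on SUBCRITICAL annulus crossings at every scale:
  **`u_{p_c−s}(L,4L) ≥ exp(−(√(d·log 85) + √(m/8)·s/((p_c−s)(1−p_c)))²)`**, `m ≤ 2d(8L+1)^d`   (`crossing_ge_exp_neg_sq_critical`),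
and likewise for the one-arm probability with the tree's critical floor `π_n(p_c) ≥ n^{−(d−1)/2}/(2d·3^{d−1})`
(`ThetaModulus.oneArmProb_criticalProbI_ge_rpow`):
  **`θ_n(p_c−s) ≥ exp(−(√(log(2d·3^{d−1}·n^{(d−1)/2})) + √(m_n/8)·s/((p_c−s)(1−p_c)))²)`**   (`thetaN_ge_exp_neg_sq_critical`).

HONEST SIZE (orientation only, `ℤ³`, `L = 64`, `m ≈ 4·10⁸`): the bound reads `u_{p_c−s} ≥ exp(−(3.7 + 3.8·10⁴ s)²)`; it beats the
trivial straight-path bound `u ≥ p^{3L} ≈ e^{−267}` for `s ≲ 2·10⁻⁴` and is the only kernel lower bound between the CCFS window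
(`s ≲ 10⁻⁷`) and that scale; the conjectured truth `u ≈ exp(−cLs^ν)` is far larger.  No rate, nothing at `p_c` itself; new as typed
(the integrated Level-1 inequality applied downward), elementary given the Level-1 inequality.

## References
* R. O'Donnell, *Analysis of Boolean Functions* (2014), §5.3 "Level-1 Inequality" [ODonnell2014].
* J. T. Chayes, L. Chayes, D. S. Fisher, T. Spencer, Phys. Rev. Lett. 57 (1986) 2999; G. Grimmett, *Percolation* (1999) Thm (2.36)(a)
  (the CCFS/Moore–Shannon window being compared) [GrimmettPercolation1999].
* H. Kesten, *Percolation theory for mathematicians* (1982), Cor. 5.1 (the `85^{−d}`-type a-priori bound, tree) [Kesten1982].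
-/

noncomputable section

namespace Summit.CriticalPhenomena.PercolationContinuityZ3.Theorems

namespace CrossingLevelOne

open MeasureTheory Set Literature.Probability.Percolation Literature.Probability.LatticeModels SurfaceTension
open scoped Classical

variable {d : ℕ}

/-! ### §1 The annulus crossing: positivity, determination, the Level-1 derivative bound -/

/-- `u_p(L,4L) > 0` for `p > 0`, `L ≥ 1`, `d ≥ 1` (since `π_p(4L) ≤ π_p(L)·u_p(L,4L)` by BK and `π_p(4L) > 0`). -/
theorem real_boxCrossing_pos (hd : 1 ≤ d) {L : ℕ} (hL : 1 ≤ L) (p : unitInterval) (hp : 0 < (p : ℝ)) :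
    0 < (bondPercolation (zdGraph d) p).real (boxCrossing d L (4 * L)) := by
  have h := Crossing.oneArmProb_four_mul_le (d := d) p hL
  have h4 : 0 < oneArmProb d p (4 * L) := DKT20.real_siteToBoundary_pos hd p hp (4 * L)
  have h1 : oneArmProb d p L ≤ 1 := measureReal_le_one
  by_contra hle
  push Not at hle
  have h0 : (bondPercolation (zdGraph d) p).real (boxCrossing d L (4 * L)) = 0 := le_antisymm hle measureReal_nonneg
  rw [h0, mul_zero] at h
  linarith

/-- The annulus crossing is determined by the `m = #edgesIn(Λ_{4L})` lattice edges inside `Λ(4L)`. -/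
theorem determinedBy_boxCrossing (L : ℕ) :
    DeterminedBy (boxCrossing d L (4 * L)) (↑(edgesIn (zdGraph d) (box d (4 * L))) : Set (Sym2 (Site d))) := by
  rw [boxCrossing_eq_linked]; exact determinedBy_linked_edgesIn _ _ _

/-- **Russo–Talagrand for the annulus crossing** (`HasDerivAt` form): for `r ∈ (0,1)`, `L ≥ 1`, `d ≥ 1`, the function
`r ↦ u_r(L,4L)` has derivative `D = Σ_e P_r(e pivotal) ≥ 0` with `D ≤ u·√(m·log(1/u)/2)/(r(1−r))`, `m = #edgesIn(Λ_{4L})`. -/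
theorem hasDerivAt_crossing_le_levelOne {L : ℕ} {r : ℝ} (hr : r ∈ Set.Ioo (0 : ℝ) 1) :
    ∃ D : ℝ, HasDerivAt (fun q : ℝ => (bondPercolation (zdGraph d) (Set.projIcc 0 1 zero_le_one q)).real (boxCrossing d L (4 * L))) D r ∧
      0 ≤ D ∧
      D ≤ (bondPercolation (zdGraph d) (Set.projIcc 0 1 zero_le_one r)).real (boxCrossing d L (4 * L)) *
          Real.sqrt ((edgesIn (zdGraph d) (box d (4 * L))).card *
            (-Real.log ((bondPercolation (zdGraph d) (Set.projIcc 0 1 zero_le_one r)).real (boxCrossing d L (4 * L)))) / 2) /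
        (r * (1 - r)) := by
  have hF := DKT20.coe_edgesIn_subset (d := d) (4 * L)
  have hA := Crossing.isUpperSet_boxCrossing (d := d) L (4 * L)
  have hAF := determinedBy_boxCrossing (d := d) L
  have hcoe : ((Set.projIcc (0 : ℝ) 1 zero_le_one r : unitInterval) : ℝ) = r :=
    congrArg Subtype.val (Set.projIcc_of_mem zero_le_one ⟨hr.1.le, hr.2.le⟩)
  refine ⟨_, SharpThreshold.hasDerivAt_real_event hF hA hAF hr, Finset.sum_nonneg fun e _ => measureReal_nonneg, ?_⟩
  have h := LevelOne.sum_pivotal_le_event hF hA hAF (Set.projIcc 0 1 zero_le_one r)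
    (by rw [hcoe]; exact hr.1) (by rw [hcoe]; exact hr.2)
  rw [hcoe] at h
  exact h

/-! ### §2 Downward integration: `√(log(1/u))` grows at most linearly as the parameter DEcreases -/

/-- **The integrated Level-1 bound, downward**: for `d ≥ 1`, `L ≥ 1`, `0 < q ≤ p < 1`,
`√(log(1/u_q(L,4L))) ≤ √(log(1/u_p(L,4L))) + √(m/8)·(p − q)/(q(1−p))`, `m = #edgesIn(Λ_{4L})` — never vacuous, unlike the
integrated Moore–Shannon bound. (`g(s) = log(1/u_{p+q−s})` satisfies `g' ≤ (√(m/2)/(q(1−p)))·√g` on `(q,p)`; then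
`ThetaModulus.sqrt_le_sqrt_add_of_deriv_le`.) -/
theorem sqrt_neg_log_crossing_le (hd : 1 ≤ d) {L : ℕ} (hL : 1 ≤ L) {q p : ℝ} (hq : 0 < q) (hqp : q ≤ p) (hp : p < 1) :
    Real.sqrt (-Real.log ((bondPercolation (zdGraph d) (Set.projIcc 0 1 zero_le_one q)).real (boxCrossing d L (4 * L)))) ≤
      Real.sqrt (-Real.log ((bondPercolation (zdGraph d) (Set.projIcc 0 1 zero_le_one p)).real (boxCrossing d L (4 * L)))) +
        Real.sqrt ((edgesIn (zdGraph d) (box d (4 * L))).card / 8) * ((p - q) / (q * (1 - p))) := by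
  set m : ℝ := ((edgesIn (zdGraph d) (box d (4 * L))).card : ℝ) with hm
  have hm0 : 0 ≤ m := Nat.cast_nonneg _
  set u : ℝ → ℝ := fun r => (bondPercolation (zdGraph d) (Set.projIcc 0 1 zero_le_one r)).real (boxCrossing d L (4 * L)) with hu
  have hqp0 : 0 < q * (1 - p) := mul_pos hq (by linarith)
  set M : ℝ := Real.sqrt (m / 2) / (q * (1 - p)) with hM
  have hM0 : 0 ≤ M := div_nonneg (Real.sqrt_nonneg _) hqp0.le
  -- positivity and continuity of `u` on `[q, p]`
  have hupos : ∀ r ∈ Set.Icc q p, 0 < u r := by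
    intro r hr
    have hr0 : 0 < r := hq.trans_le hr.1
    have hcoe : ((Set.projIcc (0 : ℝ) 1 zero_le_one r : unitInterval) : ℝ) = r :=
      congrArg Subtype.val (Set.projIcc_of_mem zero_le_one ⟨hr0.le, (hr.2.trans_lt hp).le⟩)
    exact real_boxCrossing_pos hd hL _ (by rw [hcoe]; exact hr0)
  have hucont : Continuous u :=
    (continuous_bondPercolation_real_of_determinedBy (zdGraph d) (determinedBy_boxCrossing (d := d) L)).comp continuous_projIcc
  -- the reversed function `g(s) = −log u(p+q−s)`
  set g : ℝ → ℝ := fun s => -Real.log (u (p + q - s)) with hg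
  have hmemrev : ∀ s ∈ Set.Icc q p, p + q - s ∈ Set.Icc q p := fun s hs => ⟨by linarith [hs.2], by linarith [hs.1]⟩
  have hgcont : ContinuousOn g (Set.Icc q p) := by
    refine ContinuousOn.neg (ContinuousOn.log ?_ fun s hs => (hupos _ (hmemrev s hs)).ne')
    exact (hucont.comp (continuous_const.sub continuous_id)).continuousOn
  have hg0 : ∀ s ∈ Set.Icc q p, 0 ≤ g s := fun s hs => by
    rw [hg]; simp only [neg_nonneg]
    exact Real.log_nonpos (hupos _ (hmemrev s hs)).le measureReal_le_one
  have hder : ∀ s ∈ Set.Ioo q p, ∃ D, HasDerivAt g D s ∧ D ≤ M * Real.sqrt (g s) := by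
    intro s hs
    set r := p + q - s with hrdef
    have hrI : r ∈ Set.Ioo q p := ⟨by rw [hrdef]; linarith [hs.2], by rw [hrdef]; linarith [hs.1]⟩
    have hr01 : r ∈ Set.Ioo (0 : ℝ) 1 := ⟨hq.trans hrI.1, hrI.2.trans hp⟩
    obtain ⟨D, hD, hD0, hDle⟩ := hasDerivAt_crossing_le_levelOne (d := d) (L := L) hr01
    have hur : 0 < u r := hupos r (Set.Ioo_subset_Icc_self hrI)
    -- `w = −log u` has derivative `−D/u` at `r`; `g = w ∘ (s ↦ p+q−s)` has derivative `D/u` at `s`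
    have hw : HasDerivAt (fun t => -Real.log (u t)) (-(D / u r)) r := (hD.log hur.ne').neg
    have hlin : HasDerivAt (fun s : ℝ => p + q - s) (-1) s := by
      simpa using (hasDerivAt_id s).const_sub (p + q)
    have hgD : HasDerivAt g (-(D / u r) * (-1)) s := by
      have := HasDerivAt.comp s (h₂ := fun t => -Real.log (u t)) (by rw [← hrdef]; exact hw) hlin
      exact this
    refine ⟨_, hgD, ?_⟩
    -- `D/u ≤ √(m·w/2)/(r(1−r)) ≤ (√(m/2)/(q(1−p)))·√w`
    have hrr : q * (1 - p) ≤ r * (1 - r) := by nlinarith [hrI.1, hrI.2]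
    have hgs : g s = -Real.log (u r) := by rw [hg]
    have hsplit : Real.sqrt (m * (-Real.log (u r)) / 2) = Real.sqrt (m / 2) * Real.sqrt (-Real.log (u r)) := by
      rw [show m * (-Real.log (u r)) / 2 = (m / 2) * (-Real.log (u r)) by ring, Real.sqrt_mul (by positivity)]
    have hDu : D / u r ≤ Real.sqrt (m / 2) * Real.sqrt (-Real.log (u r)) / (q * (1 - p)) := by
      rw [div_le_iff₀ hur]
      calc D ≤ u r * Real.sqrt (m * (-Real.log (u r)) / 2) / (r * (1 - r)) := hDle
        _ ≤ u r * Real.sqrt (m * (-Real.log (u r)) / 2) / (q * (1 - p)) :=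
            div_le_div_of_nonneg_left (mul_nonneg hur.le (Real.sqrt_nonneg _)) hqp0 hrr
        _ = Real.sqrt (m / 2) * Real.sqrt (-Real.log (u r)) / (q * (1 - p)) * u r := by rw [hsplit]; ring
    calc -(D / u r) * (-1) = D / u r := by ring
      _ ≤ Real.sqrt (m / 2) * Real.sqrt (-Real.log (u r)) / (q * (1 - p)) := hDu
      _ = M * Real.sqrt (g s) := by rw [hM, hgs]; ring
  have hmain := ThetaModulus.sqrt_le_sqrt_add_of_deriv_le hqp hM0 hgcont hg0 hder
  -- `g p = −log u q`, `g q = −log u p`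
  have hgp : g p = -Real.log (u q) := by simp [hg]
  have hgq : g q = -Real.log (u p) := by simp [hg]
  rw [hgp, hgq] at hmain
  have hK : M / 2 * (p - q) = Real.sqrt (m / 8) * ((p - q) / (q * (1 - p))) := by
    have h4 : Real.sqrt (m / 2) = 2 * Real.sqrt (m / 8) := by
      rw [show m / 2 = 2 ^ 2 * (m / 8) by ring, Real.sqrt_mul (by norm_num), Real.sqrt_sq (by norm_num)]
    rw [hM, h4]; field_simp
  rw [hK] at hmain
  exact hmain

/-- `x ≥ exp(−(√(log(1/x_ref)) + a)²)`-type conclusion: if `√(−log x) ≤ b` with `0 < x` then `exp(−b²) ≤ x`. -/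
theorem exp_neg_sq_le_of_sqrt_neg_log_le {x b : ℝ} (hx : 0 < x) (hb : Real.sqrt (-Real.log x) ≤ b) :
    Real.exp (-b ^ 2) ≤ x := by
  have hb0 : 0 ≤ b := (Real.sqrt_nonneg _).trans hb
  have h1 : -Real.log x ≤ b ^ 2 := by
    rcases le_or_gt 0 (-Real.log x) with hL | hL
    · calc -Real.log x = Real.sqrt (-Real.log x) ^ 2 := (Real.sq_sqrt hL).symm
        _ ≤ b ^ 2 := pow_le_pow_left₀ (Real.sqrt_nonneg _) hb 2
    · exact hL.le.trans (sq_nonneg b)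
  calc Real.exp (-b ^ 2) ≤ Real.exp (Real.log x) := Real.exp_le_exp.2 (by linarith)
    _ = x := Real.exp_log hx

/-- **Gaussian lower bound on the crossing below a reference parameter**: for `d ≥ 1`, `L ≥ 1`, `0 < q ≤ p < 1`,
`u_q(L,4L) ≥ exp(−(√(log(1/u_p(L,4L))) + √(m/8)·(p−q)/(q(1−p)))²)`. -/
theorem crossing_ge_exp_neg_sq (hd : 1 ≤ d) {L : ℕ} (hL : 1 ≤ L) {q p : ℝ} (hq : 0 < q) (hqp : q ≤ p) (hp : p < 1) :
    Real.exp (-(Real.sqrt (-Real.log ((bondPercolation (zdGraph d) (Set.projIcc 0 1 zero_le_one p)).real (boxCrossing d L (4 * L)))) +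
        Real.sqrt ((edgesIn (zdGraph d) (box d (4 * L))).card / 8) * ((p - q) / (q * (1 - p)))) ^ 2) ≤
      (bondPercolation (zdGraph d) (Set.projIcc 0 1 zero_le_one q)).real (boxCrossing d L (4 * L)) := by
  have hcoe : ((Set.projIcc (0 : ℝ) 1 zero_le_one q : unitInterval) : ℝ) = q :=
    congrArg Subtype.val (Set.projIcc_of_mem zero_le_one ⟨hq.le, (hqp.trans_lt hp).le⟩)
  exact exp_neg_sq_le_of_sqrt_neg_log_le (real_boxCrossing_pos hd hL _ (by rw [hcoe]; exact hq))
    (sqrt_neg_log_crossing_le hd hL hq hqp hp)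

/-- **Explicit Gaussian lower bound on SUBCRITICAL annulus crossings near `p_c`** (every `d ≥ 2`, `L ≥ 1`, `0 < s < p_c`):
`u_{p_c−s}(L,4L) ≥ exp(−(√(d·log 85) + √(m/8)·s/((p_c − s)(1 − p_c)))²)`, `m = #edgesIn(Λ_{4L}) ≤ 2d(8L+1)^d` — from
`u_{p_c}(L,4L) ≥ 85^{−d}` (tree) and `crossing_ge_exp_neg_sq`.  All constants kernel; no unknown quantity enters. -/
theorem crossing_ge_exp_neg_sq_critical (hd : 2 ≤ d) {L : ℕ} (hL : 1 ≤ L) {s : ℝ} (hs0 : 0 < s)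
    (hs : s < (criticalProbI d : ℝ)) :
    Real.exp (-(Real.sqrt (d * Real.log 85) +
        Real.sqrt ((edgesIn (zdGraph d) (box d (4 * L))).card / 8) * (s / (((criticalProbI d : ℝ) - s) * (1 - criticalProbI d)))) ^ 2) ≤
      (bondPercolation (zdGraph d) (Set.projIcc 0 1 zero_le_one ((criticalProbI d : ℝ) - s))).real (boxCrossing d L (4 * L)) := by
  have hpc1 : (criticalProbI d : ℝ) < 1 := by rw [coe_criticalProbI]; exact criticalProb_zd_lt_one hd
  have hq : 0 < (criticalProbI d : ℝ) - s := by linarith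
  have h := crossing_ge_exp_neg_sq (d := d) (by omega) hL hq (by linarith : (criticalProbI d : ℝ) - s ≤ criticalProbI d) hpc1
  have hproj : Set.projIcc (0 : ℝ) 1 zero_le_one (criticalProbI d : ℝ) = criticalProbI d := Set.projIcc_val zero_le_one _
  rw [hproj] at h
  refine le_trans (Real.exp_le_exp.2 ?_) h
  -- compare the two exponents: `√(−log u_{p_c}) ≤ √(d log 85)` and the linear terms agree
  have h85 : Real.sqrt (-Real.log ((bondPercolation (zdGraph d) (criticalProbI d)).real (boxCrossing d L (4 * L)))) ≤
      Real.sqrt (d * Real.log 85) := by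
    apply Real.sqrt_le_sqrt
    have hc := le_crossProb_criticalProbI hd hL
    unfold crossProb at hc
    have hc0 : (0 : ℝ) < ((85 : ℝ) ^ d)⁻¹ := by positivity
    have hlog := Real.log_le_log hc0 hc
    rw [Real.log_inv, Real.log_pow] at hlog
    change -Real.log ((bondPercolation (zdGraph d) (criticalProbI d)).real (boxCrossing d L (4 * L))) ≤ _
    linarith
  have hlin : (((criticalProbI d : ℝ) - ((criticalProbI d : ℝ) - s)) / (((criticalProbI d : ℝ) - s) * (1 - criticalProbI d))) =
      s / (((criticalProbI d : ℝ) - s) * (1 - criticalProbI d)) := by ring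
  rw [hlin]
  have hK0 : 0 ≤ Real.sqrt ((edgesIn (zdGraph d) (box d (4 * L))).card / 8) * (s / (((criticalProbI d : ℝ) - s) * (1 - criticalProbI d))) := by
    apply mul_nonneg (Real.sqrt_nonneg _)
    exact div_nonneg hs0.le (mul_nonneg hq.le (by linarith))
  have hA0 : 0 ≤ Real.sqrt (-Real.log ((bondPercolation (zdGraph d) (criticalProbI d)).real (boxCrossing d L (4 * L)))) :=
    Real.sqrt_nonneg _
  nlinarith [h85, hK0, hA0, Real.sqrt_nonneg (d * Real.log 85)]

/-! ### §3 The same for the one-arm probability, with the tree's critical floor -/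

/-- **Gaussian lower bound for the one-arm probability below a reference parameter** (`d ≥ 1`, `n ≥ 1`, `0 < q ≤ p < 1`):
`θ_n(q) ≥ exp(−(√(log(1/θ_n(p))) + √(m_n/8)·(p−q)/(q(1−p)))²)` — `OneArmLevelOne.sqrt_log_thetaN_ge` read downward. -/
theorem thetaN_ge_exp_neg_sq (hd : 1 ≤ d) {n : ℕ} (hn : 1 ≤ n) {q p : ℝ} (hq : 0 < q) (hqp : q ≤ p) (hp : p < 1) :
    Real.exp (-(Real.sqrt (-Real.log (DCT16.thetaN d n p)) +
        Real.sqrt ((edgesIn (zdGraph d) (box d n)).card / 8) * ((p - q) / (q * (1 - p)))) ^ 2) ≤ DCT16.thetaN d n q := by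
  have h := OneArmLevelOne.sqrt_log_thetaN_ge hd hn hq hqp hp
  have hθq := OneArmLevelOne.thetaN_mem_Ioo hd hn ⟨hq, hqp.trans_lt hp⟩
  exact exp_neg_sq_le_of_sqrt_neg_log_le hθq.1 (by linarith)

/-- **Explicit Gaussian lower bound on the SUBCRITICAL one-arm probability near `p_c`** (every `d ≥ 2`, `n ≥ 1`, `0 < s < p_c`):
`θ_n(p_c − s) ≥ exp(−(√(log(2d·3^{d−1}·n^{(d−1)/2})) + √(m_n/8)·s/((p_c−s)(1−p_c)))²)`, from the tree's critical floor
`π_n(p_c) ≥ n^{−(d−1)/2}/(2d·3^{d−1})` (`ThetaModulus.oneArmProb_criticalProbI_ge_rpow`).  Compare the integrated OSSS UPPER bound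
`θ_n(p_c−s) ≤ π_n(p_c)·exp(−s(1−p_c)^{2d}n/S_n(p_c))` (`FiniteSizeSharpness.thetaN_subcritical_le'`). -/
theorem thetaN_ge_exp_neg_sq_critical (hd : 2 ≤ d) {n : ℕ} (hn : 1 ≤ n) {s : ℝ} (hs0 : 0 < s)
    (hs : s < (criticalProbI d : ℝ)) :
    Real.exp (-(Real.sqrt (Real.log (2 * d * (3 : ℝ) ^ (d - 1) * (n : ℝ) ^ (((d : ℝ) - 1) / 2))) +
        Real.sqrt ((edgesIn (zdGraph d) (box d n)).card / 8) * (s / (((criticalProbI d : ℝ) - s) * (1 - criticalProbI d)))) ^ 2) ≤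
      DCT16.thetaN d n ((criticalProbI d : ℝ) - s) := by
  have hpc1 : (criticalProbI d : ℝ) < 1 := by rw [coe_criticalProbI]; exact criticalProb_zd_lt_one hd
  have hq : 0 < (criticalProbI d : ℝ) - s := by linarith
  have h := thetaN_ge_exp_neg_sq (d := d) (by omega) hn hq (by linarith : (criticalProbI d : ℝ) - s ≤ criticalProbI d) hpc1
  refine le_trans (Real.exp_le_exp.2 ?_) h
  -- the floor: `−log θ_n(p_c) ≤ log(2d 3^{d−1} n^{(d−1)/2})`
  have hfloor := ThetaModulus.oneArmProb_criticalProbI_ge_rpow hd hn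
  have hθpc : DCT16.thetaN d n (criticalProbI d : ℝ) = oneArmProb d (criticalProbI d) n := by
    have hproj : Set.projIcc (0 : ℝ) 1 zero_le_one (criticalProbI d : ℝ) = criticalProbI d := Set.projIcc_val zero_le_one _
    show (bondPercolation (zdGraph d) (Set.projIcc 0 1 zero_le_one (criticalProbI d : ℝ))).real (siteToBoundary d n) = _
    rw [hproj]; rfl
  have hd0 : (0 : ℝ) < d := by exact_mod_cast (show 0 < d by omega)
  have hn0 : (0 : ℝ) < n := by exact_mod_cast hn
  have hC0 : 0 < 2 * d * (3 : ℝ) ^ (d - 1) := by positivity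
  have hB0 : 0 < 2 * d * (3 : ℝ) ^ (d - 1) * (n : ℝ) ^ (((d : ℝ) - 1) / 2) := by positivity
  have hπ0 : 0 < oneArmProb d (criticalProbI d) n :=
    lt_of_lt_of_le (by positivity) hfloor
  have hlogle : -Real.log (DCT16.thetaN d n (criticalProbI d : ℝ)) ≤
      Real.log (2 * d * (3 : ℝ) ^ (d - 1) * (n : ℝ) ^ (((d : ℝ) - 1) / 2)) := by
    rw [hθpc]
    have h1 := Real.log_le_log (by positivity) hfloor
    rw [Real.log_mul (by positivity) (by positivity), Real.log_rpow hn0, one_div, Real.log_inv] at h1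
    rw [Real.log_mul hC0.ne' (by positivity), Real.log_rpow hn0]
    have : -(((d : ℝ) - 1) / 2) * Real.log n = -((((d : ℝ) - 1) / 2) * Real.log n) := by ring
    rw [this] at h1
    linarith
  have hsq : Real.sqrt (-Real.log (DCT16.thetaN d n (criticalProbI d : ℝ))) ≤
      Real.sqrt (Real.log (2 * d * (3 : ℝ) ^ (d - 1) * (n : ℝ) ^ (((d : ℝ) - 1) / 2))) := Real.sqrt_le_sqrt hlogle
  have hlin : (((criticalProbI d : ℝ) - ((criticalProbI d : ℝ) - s)) / (((criticalProbI d : ℝ) - s) * (1 - criticalProbI d))) =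
      s / (((criticalProbI d : ℝ) - s) * (1 - criticalProbI d)) := by ring
  rw [hlin]
  have hK0 : 0 ≤ Real.sqrt ((edgesIn (zdGraph d) (box d n)).card / 8) * (s / (((criticalProbI d : ℝ) - s) * (1 - criticalProbI d))) := by
    apply mul_nonneg (Real.sqrt_nonneg _)
    exact div_nonneg hs0.le (mul_nonneg hq.le (by linarith))
  have hA0 : 0 ≤ Real.sqrt (-Real.log (DCT16.thetaN d n (criticalProbI d : ℝ))) := Real.sqrt_nonneg _
  nlinarith [hsq, hK0, hA0, Real.sqrt_nonneg (Real.log (2 * d * (3 : ℝ) ^ (d - 1) * (n : ℝ) ^ (((d : ℝ) - 1) / 2)))]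

end CrossingLevelOne

end Summit.CriticalPhenomena.PercolationContinuityZ3.Theorems

end
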